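import Summits.NavierStokesRegularity.NavierStokesRegularity.Theorems.CalmSliceGateAsymmetricFlickerLiouvilleUnsteadinessPower
import Literature.Analysis.FluidPDE.SwirlTransportProofs
import Literature.Analysis.FluidPDE.PineauVicolRSSProofs
import Literature.Analysis.FluidPDE.AxisymmetricVorticityTransport
import Mathlib.Analysis.ODE.Gronwall
import Mathlib.Algebra.Order.ToIntervalMod
import HarnessLib

/-!
# Route `CalmSliceGate`, crux `AsymmetricFlickerLiouville` (stmt-NavierStokesRegularity-24453):
# the Killing defect of a slice — from a finite rotation defect to an infinitesimal one, and a
# class-uniform `L²` power at `t = −1`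

Theorems file of route `CalmSliceGate` (seat ns-lqd-p2 g4, cell ns-idea-3; `--supports` the wall
crux; groundwork for the registered stub `stub_asymmetryPower`, critic P1 second lemma).
Navier–Stokes regularity is NOT proved here; no summit is.

For a `C¹` field `U : ℝ³ → ℝ³`, a linear isometry `g` (the axis is `g e₃`) and a point `y`, the
FINITE rotation defect is the curve `D(θ) = U(g R_θ g⁻¹ y) − g R_θ g⁻¹ U(y)` and the KILLING
(infinitesimal) defect is `𝓛(z) = DU(z)[g J g⁻¹ z] − g J g⁻¹ U(z)` (`J = rotGen`, `D'(0) = 𝓛(y)`).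

* `hasDerivAt_defect`, `deriv_defect_zero` — `D` is differentiable with
  `D'(θ) = 𝓛(z_θ) + gJg⁻¹ D(θ)`, `z_θ = g R_θ g⁻¹ y` (`norm_deriv_defect_sub_le`), and `D'(0) = 𝓛(y)`;
* `norm_defect_le_of_killing_le` — Grönwall along the orbit circle plus `2π`-periodicity: if
  `‖𝓛‖ ≤ m` on the circle `{z_φ : φ ∈ [0, 2π]}` then `‖D(θ)‖ ≤ m (e^{2π} − 1)` for EVERY `θ`; so a
  finite defect `> δ'` forces a Killing defect `> δ'/(e^{2π} − 1)` somewhere on the circle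
  (`exists_killing_floor`);
* `exists_lipschitz_killing` — on the slice `t = −1` of a Type-I ancient mild field the Killing
  defect is Lipschitz on balls uniformly over the class (KNSS bounds on `Dw`, `D²w`);
* `exists_killing_power_of_defect` — hence a finite-defect floor on `B(0, R')` yields
  `∫_{B(0,2R')} ‖𝓛‖² ≥ c'(C, δ', R') > 0`.
-/

noncomputable section

-- the summit and its single sub-problem share the name (CONVENTIONS §1), as in every Theorems file
set_option linter.dupNamespace false

namespace Summit.NavierStokesRegularity.NavierStokesRegularity.Theorems.AsymmetricFlickerLiouville.Birth

open MeasureTheory Set Filter Topology Metric Function Real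
open Literature.Analysis Literature.Analysis.FluidPDE
open scoped ENNReal NNReal

/-! ### Rotation calculus -/

/-- `R_{θ + 2πn} = R_θ` for every integer `n`. [folklore] -/
theorem rotZ_add_int_mul_two_pi (θ : ℝ) (n : ℤ) (x : EuclideanSpace ℝ (Fin 3)) :
    rotZ (θ + n * (2 * π)) x = rotZ θ x := by
  ext i
  fin_cases i <;> simp [cos_add_int_mul_two_pi, sin_add_int_mul_two_pi]

/-- The orbit curve `θ ↦ g R_θ g⁻¹ y` has velocity `g J R_θ g⁻¹ y`. [folklore] -/
theorem hasDerivAt_conj_orbit (g : EuclideanSpace ℝ (Fin 3) ≃ₗᵢ[ℝ] EuclideanSpace ℝ (Fin 3))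
    (u : EuclideanSpace ℝ (Fin 3)) (θ : ℝ) :
    HasDerivAt (fun φ => g (rotZ φ u)) (g (rotGen (rotZ θ u))) θ := by
  have h1 : HasDerivAt (fun φ => rotZ φ u) (rotGen (rotZ θ u)) θ := by
    refine (hasDerivAt_rotZ u θ).congr_deriv ?_
    ext i; fin_cases i <;> simp [rotGen] <;> ring
  have h2 := (g.toLinearIsometry.toContinuousLinearMap.hasFDerivAt).comp_hasDerivAt θ h1
  simpa [Function.comp_def] using h2

/-- **The finite defect is differentiable in the angle**, with
`D'(θ) = DU(z_θ)[g J R_θ g⁻¹ y] − g J R_θ g⁻¹ U(y)`. [folklore] -/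
theorem hasDerivAt_defect {U : EuclideanSpace ℝ (Fin 3) → EuclideanSpace ℝ (Fin 3)}
    (hU : ContDiff ℝ 1 U) (g : EuclideanSpace ℝ (Fin 3) ≃ₗᵢ[ℝ] EuclideanSpace ℝ (Fin 3))
    (y : EuclideanSpace ℝ (Fin 3)) (θ : ℝ) :
    HasDerivAt (fun φ => U (g (rotZ φ (g.symm y))) - g (rotZ φ (g.symm (U y))))
      (fderiv ℝ U (g (rotZ θ (g.symm y))) (g (rotGen (rotZ θ (g.symm y)))) -
        g (rotGen (rotZ θ (g.symm (U y))))) θ := by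
  have hc := hasDerivAt_conj_orbit g (g.symm y) θ
  have hU' := ((hU.differentiable one_ne_zero) (g (rotZ θ (g.symm y)))).hasFDerivAt.comp_hasDerivAt θ hc
  have h2 := hasDerivAt_conj_orbit g (g.symm (U y)) θ
  simpa [Function.comp_def, Pi.sub_def] using hU'.sub h2

/-- **The Killing defect is the angular derivative of the finite defect at `θ = 0`**:
`(d/dθ)|₀ (U(gR_θg⁻¹z) − gR_θg⁻¹U(z)) = DU(z)[gJg⁻¹z] − gJg⁻¹U(z)`. [folklore] -/
theorem deriv_defect_zero {U : EuclideanSpace ℝ (Fin 3) → EuclideanSpace ℝ (Fin 3)}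
    (hU : ContDiff ℝ 1 U) (g : EuclideanSpace ℝ (Fin 3) ≃ₗᵢ[ℝ] EuclideanSpace ℝ (Fin 3))
    (z : EuclideanSpace ℝ (Fin 3)) :
    deriv (fun φ => U (g (rotZ φ (g.symm z))) - g (rotZ φ (g.symm (U z)))) 0 =
      fderiv ℝ U z (g (rotGen (g.symm z))) - g (rotGen (g.symm (U z))) := by
  rw [(hasDerivAt_defect hU g z 0).deriv]
  simp only [rotZ_zero, LinearIsometryEquiv.apply_symm_apply]

/-- **The ODE of the defect along the orbit**: `‖D'(θ) − 𝓛(z_θ)‖ ≤ ‖D(θ)‖`, `z_θ = g R_θ g⁻¹ y`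
(`D' − 𝓛(z_θ) = gJg⁻¹ D`, and `‖J‖ ≤ 1`). [folklore] -/
theorem norm_deriv_defect_sub_le {U : EuclideanSpace ℝ (Fin 3) → EuclideanSpace ℝ (Fin 3)}
    (g : EuclideanSpace ℝ (Fin 3) ≃ₗᵢ[ℝ] EuclideanSpace ℝ (Fin 3)) (y : EuclideanSpace ℝ (Fin 3)) (θ : ℝ) :
    ‖(fderiv ℝ U (g (rotZ θ (g.symm y))) (g (rotGen (rotZ θ (g.symm y)))) -
        g (rotGen (rotZ θ (g.symm (U y))))) -
      (fderiv ℝ U (g (rotZ θ (g.symm y))) (g (rotGen (g.symm (g (rotZ θ (g.symm y)))))) -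
        g (rotGen (g.symm (U (g (rotZ θ (g.symm y)))))))‖ ≤
      ‖U (g (rotZ θ (g.symm y))) - g (rotZ θ (g.symm (U y)))‖ := by
  rw [LinearIsometryEquiv.symm_apply_apply]
  have e : (fderiv ℝ U (g (rotZ θ (g.symm y))) (g (rotGen (rotZ θ (g.symm y)))) -
        g (rotGen (rotZ θ (g.symm (U y))))) -
      (fderiv ℝ U (g (rotZ θ (g.symm y))) (g (rotGen (rotZ θ (g.symm y)))) -
        g (rotGen (g.symm (U (g (rotZ θ (g.symm y))))))) =
      g (rotGenL (g.symm (U (g (rotZ θ (g.symm y))) - g (rotZ θ (g.symm (U y)))))) := by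
    rw [map_sub, map_sub, LinearIsometryEquiv.symm_apply_apply, map_sub, rotGenL_apply, rotGenL_apply]
    abel
  rw [e, LinearIsometryEquiv.norm_map, rotGenL_apply]
  refine (PineauVicol2026.norm_rotGen_le _).trans ?_
  rw [LinearIsometryEquiv.norm_map]

/-! ### Grönwall along the orbit circle -/

/-- **From a bound on the Killing defect along the orbit circle to a bound on the finite defect**
(Grönwall with `D(0) = 0`, `‖D'‖ ≤ ‖D‖ + m` on `[0, 2π]`, then `2π`-periodicity in the angle):
if `‖DU(z_φ)[gJg⁻¹z_φ] − gJg⁻¹U(z_φ)‖ ≤ m` for all `φ ∈ [0, 2π]`, then for EVERY `θ`,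
`‖U(gR_θg⁻¹y) − gR_θg⁻¹U(y)‖ ≤ m(e^{2π} − 1)`. [folklore] -/
theorem norm_defect_le_of_killing_le {U : EuclideanSpace ℝ (Fin 3) → EuclideanSpace ℝ (Fin 3)}
    (hU : ContDiff ℝ 1 U) (g : EuclideanSpace ℝ (Fin 3) ≃ₗᵢ[ℝ] EuclideanSpace ℝ (Fin 3))
    (y : EuclideanSpace ℝ (Fin 3)) {m : ℝ} (hm : 0 ≤ m)
    (hkill : ∀ φ ∈ Icc (0 : ℝ) (2 * π),
      ‖fderiv ℝ U (g (rotZ φ (g.symm y))) (g (rotGen (g.symm (g (rotZ φ (g.symm y)))))) -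
        g (rotGen (g.symm (U (g (rotZ φ (g.symm y))))))‖ ≤ m) (θ : ℝ) :
    ‖U (g (rotZ θ (g.symm y))) - g (rotZ θ (g.symm (U y)))‖ ≤ m * (exp (2 * π) - 1) := by
  set D : ℝ → EuclideanSpace ℝ (Fin 3) := fun φ => U (g (rotZ φ (g.symm y))) - g (rotZ φ (g.symm (U y)))
    with hD
  set D' : ℝ → EuclideanSpace ℝ (Fin 3) := fun φ =>
    fderiv ℝ U (g (rotZ φ (g.symm y))) (g (rotGen (rotZ φ (g.symm y)))) -
      g (rotGen (rotZ φ (g.symm (U y)))) with hD'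
  have hderiv : ∀ φ, HasDerivAt D (D' φ) φ := fun φ => hasDerivAt_defect hU g y φ
  -- Grönwall on `[0, 2π]`
  have hgr := norm_le_gronwallBound_of_norm_deriv_right_le (f := D) (f' := D') (δ := 0) (K := 1)
    (ε := m) (a := 0) (b := 2 * π)
    (fun φ _ => (hderiv φ).continuousAt.continuousWithinAt)
    (fun φ _ => (hderiv φ).hasDerivWithinAt) (by simp [hD]) (fun φ hφ => ?_)
  swap
  · have h1 := norm_deriv_defect_sub_le (U := U) g y φ
    have h2 := hkill φ (Ico_subset_Icc_self hφ)
    have h3 := norm_le_norm_add_norm_sub' (D' φ)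
      (fderiv ℝ U (g (rotZ φ (g.symm y))) (g (rotGen (g.symm (g (rotZ φ (g.symm y)))))) -
        g (rotGen (g.symm (U (g (rotZ φ (g.symm y)))))))
    rw [one_mul]
    linarith
  -- reduce `θ` modulo `2π`
  have h2π : 0 < 2 * π := by positivity
  set θ₁ : ℝ := toIcoMod h2π 0 θ with hθ₁
  have hθ₁I : θ₁ ∈ Ico (0 : ℝ) (0 + 2 * π) := toIcoMod_mem_Ico h2π 0 θ
  have hper : D θ = D θ₁ := by
    have e : θ = θ₁ + (toIcoDiv h2π 0 θ : ℤ) * (2 * π) := by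
      have := (toIcoMod_add_toIcoDiv_zsmul h2π 0 θ).symm
      rwa [zsmul_eq_mul] at this
    simp only [hD]
    rw [e, rotZ_add_int_mul_two_pi, rotZ_add_int_mul_two_pi]
  have hb := hgr θ₁ ⟨hθ₁I.1, by linarith [hθ₁I.2]⟩
  rw [gronwallBound_of_K_ne_0 one_ne_zero] at hb
  simp only [sub_zero, one_mul, zero_mul, zero_add, div_one] at hb
  have hexp : exp θ₁ - 1 ≤ exp (2 * π) - 1 := by
    have := exp_le_exp.2 (show θ₁ ≤ 2 * π by linarith [hθ₁I.2]); linarith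
  calc ‖U (g (rotZ θ (g.symm y))) - g (rotZ θ (g.symm (U y)))‖ = ‖D θ₁‖ := by
        rw [← hper]
    _ ≤ m * (exp θ₁ - 1) := hb
    _ ≤ m * (exp (2 * π) - 1) := mul_le_mul_of_nonneg_left hexp hm

/-- **A finite-defect floor forces a Killing-defect floor on the orbit circle**: if
`δ' < ‖U(gR_θg⁻¹y) − gR_θg⁻¹U(y)‖` then some `z = gR_φg⁻¹y` (so `‖z‖ = ‖y‖`) has
`‖DU(z)[gJg⁻¹z] − gJg⁻¹U(z)‖ > δ'/(e^{2π} − 1)`. [folklore] -/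
theorem exists_killing_floor {U : EuclideanSpace ℝ (Fin 3) → EuclideanSpace ℝ (Fin 3)}
    (hU : ContDiff ℝ 1 U) (g : EuclideanSpace ℝ (Fin 3) ≃ₗᵢ[ℝ] EuclideanSpace ℝ (Fin 3))
    {y : EuclideanSpace ℝ (Fin 3)} {θ δ' : ℝ}
    (hdef : δ' < ‖U (g (rotZ θ (g.symm y))) - g (rotZ θ (g.symm (U y)))‖) :
    ∃ z : EuclideanSpace ℝ (Fin 3), ‖z‖ = ‖y‖ ∧
      δ' / (exp (2 * π) - 1) < ‖fderiv ℝ U z (g (rotGen (g.symm z))) - g (rotGen (g.symm (U z)))‖ := by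
  by_contra hcon
  push Not at hcon
  have hE : 0 < exp (2 * π) - 1 := by
    have := add_one_lt_exp (by positivity : (2 * π) ≠ 0)
    linarith [Real.pi_pos]
  rcases lt_or_ge δ' 0 with hneg | hnn
  · -- trivial when `δ' < 0`: the floor says nothing... but then `hcon` at `z = y` is impossible only
    -- if norms could be negative; use instead the bound with `m = 0`-shifted: take `z = y`.
    have h0 := hcon y rfl
    have : (0 : ℝ) ≤ ‖fderiv ℝ U y (g (rotGen (g.symm y))) - g (rotGen (g.symm (U y)))‖ := norm_nonneg _
    have : δ' / (exp (2 * π) - 1) < 0 := div_neg_of_neg_of_pos hneg hE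
    linarith
  · have hm : 0 ≤ δ' / (exp (2 * π) - 1) := div_nonneg hnn hE.le
    have hb := norm_defect_le_of_killing_le hU g y hm (fun φ _ => ?_) θ
    · rw [div_mul_cancel₀ _ hE.ne'] at hb
      linarith
    · have hz : ‖g (rotZ φ (g.symm y))‖ = ‖y‖ := by
        rw [LinearIsometryEquiv.norm_map, norm_rotZ, LinearIsometryEquiv.norm_map]
      exact hcon _ hz


/-! ### The Killing defect on the slice `t = −1`: class-uniform Lipschitz bound and `L²` power -/

/-- `‖g J g⁻¹ u‖ ≤ ‖u‖` and `gJg⁻¹` is additive. [folklore] -/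
theorem norm_conjGen_le (g : EuclideanSpace ℝ (Fin 3) ≃ₗᵢ[ℝ] EuclideanSpace ℝ (Fin 3))
    (u : EuclideanSpace ℝ (Fin 3)) : ‖g (rotGen (g.symm u))‖ ≤ ‖u‖ := by
  rw [LinearIsometryEquiv.norm_map]
  exact (PineauVicol2026.norm_rotGen_le _).trans (le_of_eq (g.symm.norm_map u))

/-- `gJg⁻¹ u − gJg⁻¹ u' = gJg⁻¹ (u − u')`. [folklore] -/
theorem conjGen_sub (g : EuclideanSpace ℝ (Fin 3) ≃ₗᵢ[ℝ] EuclideanSpace ℝ (Fin 3))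
    (u u' : EuclideanSpace ℝ (Fin 3)) :
    g (rotGen (g.symm u)) - g (rotGen (g.symm u')) = g (rotGen (g.symm (u - u'))) := by
  rw [← map_sub, ← rotGenL_apply, ← rotGenL_apply, ← rotGenL_apply, ← map_sub, ← map_sub]

/-- **The Killing defect of the slice `−1` of a Type-I ancient mild field is Lipschitz on balls,
uniformly over the class and the axis**: for `‖z‖, ‖z'‖ ≤ ρ₀`,
`‖𝓛(z) − 𝓛(z')‖ ≤ Λ'(C, ρ₀) ‖z − z'‖` (KNSS bounds on `Dw(−1)`, `D²w(−1)`). [cite: KochNadirashviliSereginSverak2009, §4 (4.10) (arXiv:0709.3599 p. 8)] -/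
theorem exists_lipschitz_killing (C ρ₀ : ℝ) (hρ₀ : 0 ≤ ρ₀) :
    ∃ Λ : ℝ, 0 ≤ Λ ∧ ∀ ⦃w : ℝ → EuclideanSpace ℝ (Fin 3) → EuclideanSpace ℝ (Fin 3)⦄,
      IsTypeIAncientMild C w → ∀ g : EuclideanSpace ℝ (Fin 3) ≃ₗᵢ[ℝ] EuclideanSpace ℝ (Fin 3),
      ∀ z ∈ closedBall (0 : EuclideanSpace ℝ (Fin 3)) ρ₀, ∀ z' ∈ closedBall (0 : EuclideanSpace ℝ (Fin 3)) ρ₀,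
        ‖(fderiv ℝ (w (-1)) z (g (rotGen (g.symm z))) - g (rotGen (g.symm (w (-1) z)))) -
          (fderiv ℝ (w (-1)) z' (g (rotGen (g.symm z'))) - g (rotGen (g.symm (w (-1) z'))))‖ ≤
          Λ * ‖z - z'‖ := by
  obtain ⟨K₁, hK₁0, hK₁⟩ := exists_bound_fderiv_slice C
  obtain ⟨K₂, hK₂0, hK₂⟩ := exists_bound_fderiv_fderiv_slice C
  refine ⟨ρ₀ * K₂ + 2 * K₁, by positivity, fun w hw g z hz z' hz' => ?_⟩
  have hc : ContDiff ℝ (⊤ : ℕ∞) (w (-1)) := hw.contDiff_slice (by norm_num)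
  have hzn : ‖z‖ ≤ ρ₀ := mem_closedBall_zero_iff.1 hz
  -- Lipschitz bounds for `w(-1)` and `Dw(-1)`
  have h2 : ‖w (-1) z - w (-1) z'‖ ≤ K₁ * ‖z - z'‖ :=
    (convex_univ (𝕜 := ℝ) (E := EuclideanSpace ℝ (Fin 3))).norm_image_sub_le_of_norm_fderiv_le
      (fun x _ => (hc.differentiable (by simp)) x) (fun x _ => hK₁ hw x) (mem_univ z') (mem_univ z)
  have h3 : ‖fderiv ℝ (w (-1)) z - fderiv ℝ (w (-1)) z'‖ ≤ K₂ * ‖z - z'‖ := by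
    have hd : ∀ x, DifferentiableAt ℝ (fderiv ℝ (w (-1))) x := fun x =>
      ((hc.fderiv_right (m := 1) (by norm_cast)).differentiable one_ne_zero) x
    exact (convex_univ (𝕜 := ℝ) (E := EuclideanSpace ℝ (Fin 3))).norm_image_sub_le_of_norm_fderiv_le
      (fun x _ => hd x) (fun x _ => hK₂ hw x) (mem_univ z') (mem_univ z)
  -- decomposition
  have e : (fderiv ℝ (w (-1)) z (g (rotGen (g.symm z))) - g (rotGen (g.symm (w (-1) z)))) -
      (fderiv ℝ (w (-1)) z' (g (rotGen (g.symm z'))) - g (rotGen (g.symm (w (-1) z')))) =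
      ((fderiv ℝ (w (-1)) z (g (rotGen (g.symm z))) - fderiv ℝ (w (-1)) z' (g (rotGen (g.symm z)))) +
        fderiv ℝ (w (-1)) z' (g (rotGen (g.symm z)) - g (rotGen (g.symm z')))) -
        (g (rotGen (g.symm (w (-1) z))) - g (rotGen (g.symm (w (-1) z')))) := by
    rw [map_sub]; abel
  rw [e, conjGen_sub g z z', conjGen_sub g (w (-1) z) (w (-1) z')]
  have hA : ‖fderiv ℝ (w (-1)) z (g (rotGen (g.symm z))) - fderiv ℝ (w (-1)) z' (g (rotGen (g.symm z)))‖ ≤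
      K₂ * ‖z - z'‖ * ρ₀ := by
    refine ((fderiv ℝ (w (-1)) z - fderiv ℝ (w (-1)) z').le_opNorm (g (rotGen (g.symm z)))).trans ?_
    exact mul_le_mul h3 ((norm_conjGen_le g z).trans hzn) (norm_nonneg _)
      (mul_nonneg hK₂0 (norm_nonneg _))
  have hB : ‖fderiv ℝ (w (-1)) z' (g (rotGen (g.symm (z - z'))))‖ ≤ K₁ * ‖z - z'‖ := by
    refine ((fderiv ℝ (w (-1)) z').le_opNorm _).trans ?_
    exact mul_le_mul (hK₁ hw z') (norm_conjGen_le g _) (norm_nonneg _) hK₁0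
  have hC : ‖g (rotGen (g.symm (w (-1) z - w (-1) z')))‖ ≤ K₁ * ‖z - z'‖ :=
    (norm_conjGen_le g _).trans h2
  calc ‖((fderiv ℝ (w (-1)) z (g (rotGen (g.symm z))) - fderiv ℝ (w (-1)) z' (g (rotGen (g.symm z)))) +
        fderiv ℝ (w (-1)) z' (g (rotGen (g.symm (z - z'))))) - g (rotGen (g.symm (w (-1) z - w (-1) z')))‖
      ≤ (‖fderiv ℝ (w (-1)) z (g (rotGen (g.symm z))) - fderiv ℝ (w (-1)) z' (g (rotGen (g.symm z)))‖ +
          ‖fderiv ℝ (w (-1)) z' (g (rotGen (g.symm (z - z'))))‖) +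
          ‖g (rotGen (g.symm (w (-1) z - w (-1) z')))‖ :=
        (norm_sub_le _ _).trans (add_le_add (norm_add_le _ _) le_rfl)
    _ ≤ (K₂ * ‖z - z'‖ * ρ₀ + K₁ * ‖z - z'‖) + K₁ * ‖z - z'‖ := add_le_add (add_le_add hA hB) hC
    _ = (ρ₀ * K₂ + 2 * K₁) * ‖z - z'‖ := by ring

/-- **Finite-defect floor ⇒ Killing power, at `t = −1`, uniformly over the class and the axis**:
there is `c' = c'(C, δ', R') > 0` such that for every Type-I ancient mild `w` (constant `C`) and
every linear isometry `g`, a finite rotation defect `δ' < ‖w(−1)(gR_θg⁻¹y) − gR_θg⁻¹w(−1)(y)‖` at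
some angle `θ` and some `‖y‖ < R'` forces `∫_{B(0,2R')} ‖𝓛‖² ≥ c'` for the Killing defect
`𝓛(z) = Dw(−1)(z)[gJg⁻¹z] − gJg⁻¹w(−1)(z)` (Grönwall floor transfer to the orbit circle, then
Lipschitz persistence on a ball of class-uniform radius). [cite: KochNadirashviliSereginSverak2009, §4 (4.10) (arXiv:0709.3599 p. 8)] -/
theorem exists_killing_power_of_defect (C δ' R' : ℝ) (hδ' : 0 < δ') (hR' : 0 < R') :
    ∃ c' > 0, ∀ ⦃w : ℝ → EuclideanSpace ℝ (Fin 3) → EuclideanSpace ℝ (Fin 3)⦄,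
      IsTypeIAncientMild C w → ∀ g : EuclideanSpace ℝ (Fin 3) ≃ₗᵢ[ℝ] EuclideanSpace ℝ (Fin 3),
      (∃ θ : ℝ, ∃ y ∈ ball (0 : EuclideanSpace ℝ (Fin 3)) R',
        δ' < ‖w (-1) (g (rotZ θ (g.symm y))) - g (rotZ θ (g.symm (w (-1) y)))‖) →
      ENNReal.ofReal c' ≤ ∫⁻ z in ball (0 : EuclideanSpace ℝ (Fin 3)) (2 * R'),
        ‖fderiv ℝ (w (-1)) z (g (rotGen (g.symm z))) - g (rotGen (g.symm (w (-1) z)))‖ₑ ^ 2 := by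
  obtain ⟨Λ, hΛ0, hΛ⟩ := exists_lipschitz_killing C (2 * R') (by positivity)
  have hE : 0 < exp (2 * π) - 1 := by
    have := add_one_lt_exp (by positivity : (2 * π) ≠ 0)
    linarith [Real.pi_pos]
  set δ'' : ℝ := δ' / (exp (2 * π) - 1) with hδ''
  have hδ''pos : 0 < δ'' := div_pos hδ' hE
  set ρ : ℝ := min R' (δ'' / (2 * (Λ + 1))) with hρ
  have hρpos : 0 < ρ := lt_min hR' (by positivity)
  have hρR : ρ ≤ R' := min_le_left _ _
  have hρΛ : Λ * ρ ≤ δ'' / 2 := by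
    have h1 : ρ ≤ δ'' / (2 * (Λ + 1)) := min_le_right _ _
    have h2 : Λ * ρ ≤ Λ * (δ'' / (2 * (Λ + 1))) := mul_le_mul_of_nonneg_left h1 hΛ0
    have h3 : Λ * (δ'' / (2 * (Λ + 1))) ≤ δ'' / 2 := by
      rw [mul_div_assoc', div_le_div_iff₀ (by positivity) (by positivity)]
      nlinarith
    linarith
  have hvol : 0 < volume (ball (0 : EuclideanSpace ℝ (Fin 3)) ρ) := measure_ball_pos _ _ hρpos
  have hvol' : volume (ball (0 : EuclideanSpace ℝ (Fin 3)) ρ) < ⊤ := measure_ball_lt_top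
  refine ⟨(δ'' / 2) ^ 2 * (volume (ball (0 : EuclideanSpace ℝ (Fin 3)) ρ)).toReal,
    mul_pos (by positivity) (ENNReal.toReal_pos hvol.ne' hvol'.ne), fun w hw g ⟨θ, y, hy, hdef⟩ => ?_⟩
  have hc1 : ContDiff ℝ 1 (w (-1)) := (hw.contDiff_slice (by norm_num)).of_le (by exact_mod_cast le_top)
  -- a Killing floor on the orbit circle
  obtain ⟨z₀, hz₀n, hfloor⟩ := exists_killing_floor hc1 g hdef
  have hz₀R : ‖z₀‖ < R' := by rw [hz₀n]; exact mem_ball_zero_iff.1 hy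
  -- Lipschitz persistence on `ball z₀ ρ ⊆ ball 0 (2R')`
  have hsub : ball z₀ ρ ⊆ ball (0 : EuclideanSpace ℝ (Fin 3)) (2 * R') := by
    intro z hz
    rw [mem_ball_zero_iff]
    have h1 : ‖z - z₀‖ < ρ := mem_ball_iff_norm.1 hz
    have h2 : ‖z‖ ≤ ‖z - z₀‖ + ‖z₀‖ := norm_le_norm_sub_add z z₀
    linarith
  have hbig : ∀ z ∈ ball z₀ ρ, ENNReal.ofReal ((δ'' / 2) ^ 2) ≤
      ‖fderiv ℝ (w (-1)) z (g (rotGen (g.symm z))) - g (rotGen (g.symm (w (-1) z)))‖ₑ ^ 2 := by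
    intro z hz
    have hz2 : z ∈ closedBall (0 : EuclideanSpace ℝ (Fin 3)) (2 * R') := ball_subset_closedBall (hsub hz)
    have hz₀2 : z₀ ∈ closedBall (0 : EuclideanSpace ℝ (Fin 3)) (2 * R') :=
      mem_closedBall_zero_iff.2 (by linarith)
    have hdist : ‖z - z₀‖ < ρ := mem_ball_iff_norm.1 hz
    have hge : δ'' / 2 ≤ ‖fderiv ℝ (w (-1)) z (g (rotGen (g.symm z))) - g (rotGen (g.symm (w (-1) z)))‖ := by
      have htri := norm_le_norm_add_norm_sub'
        (fderiv ℝ (w (-1)) z₀ (g (rotGen (g.symm z₀))) - g (rotGen (g.symm (w (-1) z₀))))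
        (fderiv ℝ (w (-1)) z (g (rotGen (g.symm z))) - g (rotGen (g.symm (w (-1) z))))
      have hlip := hΛ hw g z₀ hz₀2 z hz2
      rw [norm_sub_rev z₀ z] at hlip
      have hΛd : Λ * ‖z - z₀‖ ≤ δ'' / 2 := (mul_le_mul_of_nonneg_left hdist.le hΛ0).trans hρΛ
      linarith
    rw [← ofReal_norm, ← ENNReal.ofReal_pow (norm_nonneg _)]
    exact ENNReal.ofReal_le_ofReal (pow_le_pow_left₀ (by positivity) hge 2)
  calc ENNReal.ofReal ((δ'' / 2) ^ 2 * (volume (ball (0 : EuclideanSpace ℝ (Fin 3)) ρ)).toReal)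
      = ENNReal.ofReal ((δ'' / 2) ^ 2) * volume (ball z₀ ρ) := by
        rw [ENNReal.ofReal_mul (by positivity), ENNReal.ofReal_toReal hvol'.ne,
          Measure.addHaar_ball_center volume z₀ ρ]
    _ = ∫⁻ _ in ball z₀ ρ, ENNReal.ofReal ((δ'' / 2) ^ 2) := by rw [setLIntegral_const]
    _ ≤ ∫⁻ z in ball z₀ ρ, ‖fderiv ℝ (w (-1)) z (g (rotGen (g.symm z))) -
          g (rotGen (g.symm (w (-1) z)))‖ₑ ^ 2 := setLIntegral_mono' measurableSet_ball hbig
    _ ≤ ∫⁻ z in ball (0 : EuclideanSpace ℝ (Fin 3)) (2 * R'), ‖fderiv ℝ (w (-1)) z (g (rotGen (g.symm z))) -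
          g (rotGen (g.symm (w (-1) z)))‖ₑ ^ 2 := lintegral_mono_set hsub

end Summit.NavierStokesRegularity.NavierStokesRegularity.Theorems.AsymmetricFlickerLiouville.Birth

end
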